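import Literature.MathematicalPhysics.QuantumManyBody.PeriodicMaxFormBoundHardCore
import Literature.MathematicalPhysics.QuantumManyBody.PeriodicMaxFormGroundStates
import HarnessLib

/-!
# Crux `GridInfDivCoherence` (stmt-AtomisticToContinuum-9114), line `registered`: the parallelogram step
# `stub_maxForm_add_smul_le` of the positivity-necessity theorem (lead c6)

Fixed box `L > 0`, repulsive finite-range `v` (hard cores allowed), `E₀ = periodicGroundStateEnergy v N L < ∞`.
For a UNIT maximal-form ground state `f ∈ maxFormGroundStates v N L` and a Bose-symmetric direction `g`, the
second-order variation `f + s g` (`s` real) satisfies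

  `maxForm (f + s g) ≤ E₀ ‖f + s g‖² + 2 s² maxForm g`.

Proof (`Q := maxForm v L`). Parallelogram law of the maximal form (`maxForm_parallelogram`):
`Q(f + s g) + Q(f - s g) = 2 Q f + 2 Q(s g) = 2 Q f + 2 s² Q g ≤ 2 E₀ + 2 s² Q g` (`Q f ≤ E₀ ‖f‖² = E₀`,
`maxForm_smul`). MaxFormBound for finite-range potentials on the Bose sector
(`periodicGroundStateEnergy_mul_le_maxForm_finiteRange`): `E₀ ‖f - s g‖² ≤ Q(f - s g)`. Hilbert parallelogram law:
`‖f + s g‖² + ‖f - s g‖² = 2 + 2 s² ‖g‖² ≥ 2`, so `2 E₀ ≤ E₀ ‖f + s g‖² + E₀ ‖f - s g‖²`. Hence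
`Q(f + s g) + E₀ ‖f - s g‖² ≤ E₀ ‖f + s g‖² + 2 s² Q g + E₀ ‖f - s g‖²`, and the finite term `E₀ ‖f - s g‖²`
cancels in `[0, ∞]`.

References: Reed–Simon IV Thm XIII.64 [ReedSimonIV1978]; B. Simon, J. Operator Theory 1 (1979) 37–47.
-/

noncomputable section

namespace Summit.AtomisticToContinuum.BoseEinsteinCondensation.Theorems

open MeasureTheory Filter Literature.MathematicalPhysics.QuantumManyBody Literature.MathematicalPhysics.QuantumManyBody.BoseGas
  Literature.Analysis.FunctionSpaces
open scoped ENNReal NNReal ComplexConjugate InnerProductSpace Topology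

attribute [local instance] formDomain_measureSpace formDomain_isProbabilityMeasure formDomain_isProbabilityMeasure_pi

namespace MaxFormAddSmul

variable {N : ℕ} {L : ℝ} {v : ℝ → ℝ≥0∞}

/-- **MaxFormBound on the Bose sector for repulsive finite-range `v` (hard cores allowed)**, in `maxForm` dress:
`E₀ ‖η‖² ≤ maxForm v L η` for every Bose-symmetric `η`. [folklore] -/
theorem periodicGroundStateEnergy_mul_le_maxForm_of_isRepulsiveFiniteRange (hv : IsRepulsiveFiniteRange v)
    (hL : 0 < L) {η : Lp ℂ 2 (volume : Measure (UnitAddTorus (Fin N × Fin 3)))} (hη : η ∈ boseSymmetric N) :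
    periodicGroundStateEnergy v N L * ENNReal.ofReal (‖η‖ ^ 2) ≤ maxForm v L η := by
  obtain ⟨R₀, hv0⟩ := hv.2
  exact periodicGroundStateEnergy_mul_le_maxForm_finiteRange hL hv.1 hv0 η hη

/-- Scaling of the maximal form by a real scalar: `maxForm (s • η) = s² maxForm η`. [folklore] -/
theorem maxForm_real_smul (v : ℝ → ℝ≥0∞) (L : ℝ) (s : ℝ)
    (η : Lp ℂ 2 (volume : Measure (UnitAddTorus (Fin N × Fin 3)))) :
    maxForm v L ((s : ℂ) • η) = ENNReal.ofReal (s ^ 2) * maxForm v L η := by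
  rw [maxForm_smul, Complex.norm_real, Real.norm_eq_abs, sq_abs]

/-- The Hilbert-space parallelogram law at a unit vector: `2 ≤ ‖f + ξ‖² + ‖f - ξ‖²`. [folklore] -/
theorem two_le_norm_add_sq_add_norm_sub_sq {f : Lp ℂ 2 (volume : Measure (UnitAddTorus (Fin N × Fin 3)))}
    (hf1 : ‖f‖ = 1) (ξ : Lp ℂ 2 (volume : Measure (UnitAddTorus (Fin N × Fin 3)))) :
    (2 : ℝ) ≤ ‖f + ξ‖ ^ 2 + ‖f - ξ‖ ^ 2 := by
  have h := parallelogram_law_with_norm ℂ f ξ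
  rw [hf1] at h
  simp only [sq] at h ⊢
  nlinarith [h, mul_self_nonneg ‖ξ‖]

end MaxFormAddSmul

/-- **Parallelogram step of the positivity-necessity theorem.** For `L > 0`, a repulsive finite-range `v` with
`E₀ = periodicGroundStateEnergy v N L < ∞`, a unit maximal-form ground state `f`, a Bose-symmetric `g` and a real
`s`: `maxForm (f + s g) ≤ E₀ ‖f + s g‖² + 2 s² maxForm g` (parallelogram law of the maximal form, the scaling
`maxForm (s g) = s² maxForm g`, and the MaxFormBound `E₀ ‖f - s g‖² ≤ maxForm (f - s g)` on the Bose sector).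
[cite: ReedSimonIV1978, Thm XIII.64] -/
theorem stub_maxForm_add_smul_le :
    ∀ (N : ℕ) (L : ℝ) (v : ℝ → ℝ≥0∞), IsRepulsiveFiniteRange v → 0 < L →
      periodicGroundStateEnergy v N L ≠ ⊤ →
      ∀ f : Lp ℂ 2 (volume : Measure (UnitAddTorus (Fin N × Fin 3))),
        f ∈ maxFormGroundStates v N L → ‖f‖ = 1 →
        ∀ g : Lp ℂ 2 (volume : Measure (UnitAddTorus (Fin N × Fin 3))),
          g ∈ boseSymmetric N → maxForm v L g ≠ ⊤ → ∀ s : ℝ,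
            maxForm v L (f + (s : ℂ) • g) ≤
              periodicGroundStateEnergy v N L * ENNReal.ofReal (‖f + (s : ℂ) • g‖ ^ 2) +
                2 * ENNReal.ofReal (s ^ 2) * maxForm v L g := by
  intro N L v hv hL hE f hf hf1 g hg _ s
  set E := periodicGroundStateEnergy v N L with hEdef
  set ξ : Lp ℂ 2 (volume : Measure (UnitAddTorus (Fin N × Fin 3))) := (s : ℂ) • g with hξdef
  -- `Q f ≤ E₀` for the unit ground state `f`
  have hQf : maxForm v L f ≤ E := by
    have h := hf.2
    rwa [hf1, one_pow, ENNReal.ofReal_one, mul_one] at h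
  -- `Q (s g) = s² Q g`
  have hQξ : maxForm v L ξ = ENNReal.ofReal (s ^ 2) * maxForm v L g := MaxFormAddSmul.maxForm_real_smul v L s g
  -- MaxFormBound at `f - s g ∈ boseSymmetric N`
  have hlow : E * ENNReal.ofReal (‖f - ξ‖ ^ 2) ≤ maxForm v L (f - ξ) :=
    MaxFormAddSmul.periodicGroundStateEnergy_mul_le_maxForm_of_isRepulsiveFiniteRange hv hL
      ((boseSymmetric N).sub_mem hf.1 ((boseSymmetric N).smul_mem _ hg))
  -- parallelogram law of the maximal form
  have h1 : maxForm v L (f + ξ) + maxForm v L (f - ξ) ≤ 2 * E + 2 * (ENNReal.ofReal (s ^ 2) * maxForm v L g) := by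
    rw [maxForm_parallelogram hv.1, ← hQξ]
    gcongr
  -- Hilbert parallelogram law: `2 E₀ ≤ E₀ ‖f + s g‖² + E₀ ‖f - s g‖²`
  have h2 : 2 * E ≤ E * ENNReal.ofReal (‖f + ξ‖ ^ 2) + E * ENNReal.ofReal (‖f - ξ‖ ^ 2) := by
    have h2' : ENNReal.ofReal 2 ≤ ENNReal.ofReal (‖f + ξ‖ ^ 2 + ‖f - ξ‖ ^ 2) :=
      ENNReal.ofReal_le_ofReal (MaxFormAddSmul.two_le_norm_add_sq_add_norm_sub_sq hf1 ξ)
    rw [ENNReal.ofReal_ofNat] at h2'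
    calc 2 * E = E * 2 := mul_comm _ _
      _ ≤ E * ENNReal.ofReal (‖f + ξ‖ ^ 2 + ‖f - ξ‖ ^ 2) := mul_le_mul' le_rfl h2'
      _ = E * ENNReal.ofReal (‖f + ξ‖ ^ 2) + E * ENNReal.ofReal (‖f - ξ‖ ^ 2) := by
          rw [ENNReal.ofReal_add (sq_nonneg _) (sq_nonneg _), mul_add]
  have hfin : E * ENNReal.ofReal (‖f - ξ‖ ^ 2) ≠ ⊤ := ENNReal.mul_ne_top hE ENNReal.ofReal_ne_top
  refine (ENNReal.add_le_add_iff_right hfin).1 ?_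
  calc maxForm v L (f + ξ) + E * ENNReal.ofReal (‖f - ξ‖ ^ 2)
      ≤ maxForm v L (f + ξ) + maxForm v L (f - ξ) := add_le_add_right hlow _
    _ ≤ 2 * E + 2 * (ENNReal.ofReal (s ^ 2) * maxForm v L g) := h1
    _ ≤ E * ENNReal.ofReal (‖f + ξ‖ ^ 2) + E * ENNReal.ofReal (‖f - ξ‖ ^ 2) +
          2 * (ENNReal.ofReal (s ^ 2) * maxForm v L g) := add_le_add_left h2 _
    _ = E * ENNReal.ofReal (‖f + ξ‖ ^ 2) + 2 * ENNReal.ofReal (s ^ 2) * maxForm v L g +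
          E * ENNReal.ofReal (‖f - ξ‖ ^ 2) := by ring

end Summit.AtomisticToContinuum.BoseEinsteinCondensation.Theorems

end
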